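/-
Copyright: the b2b-balaban T⁴-continuum CRUX team, row NE7b OWNER lineage `t4-ne7b-p1` (gen 135). Project licence.
-/
import Summits.QuantumFields.BalabanUV.T4Continuum.Spine.NE7b.SupPolymerLocalStepLinearLetter

/-!
# THE NEXT SINGLE-BLOCK FACTOR IS REGULATED — (290) ONE SCALE UP, FROM THE UNEXPANDED INTEGRAL: for a finite family `𝒜` of `R`-connected
# cell sets inside a block `D` (the road's input class on one block: factors `f_X` local in the field, singletons regulated `(ε, κ)`, larger sets
# sup-small `ε^{#X}`) and the Gaussian road `N(0,Γ)` (`Γ ⪯ γ_op·1`, diagonal `≤ γ`, disjoint cells of `≤ v` sites, `κ(1+τ)γ_op ≤ θ < 1`), the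
# UNEXPANDED block factor `g⁺_D(ψ) := Z_ψ(𝒜) − 1 = ∫∏_{X∈𝒜}(1 + f_X(ω+ψ))dN(0,Γ)(ω) − 1` obeys, for EVERY external field `ψ`,
#   `‖g⁺_D(ψ)‖ ≤ max(2η_D, (1 + S·A_τ^{#cells D})·e^{−(κ⁺−κ₁)Ψ²∕2}) · e^{½κ⁺Σ_{x ∈ cells D}ψ_x²}`,   `κ₁ = κ(1+τ⁻¹) ≤ κ⁺`,
# `S = ∏_{X∈𝒜}(1 + ε^{#X}) ≤ e^{(1+ε)^{#D}}`, `η_D = #(⋃𝒜)(Δ+1)2e·ε₁`, `ε₁ = 2e(Δ+1)²ε″`, `ε″ = εe^{½κ₁Ψ²}A_τ^v`, `A_τ = (1−θ)^{−κ(1+τ)γ∕(2θ)}` —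
# small fields (`Σ_{cell p}ψ² ≤ Ψ²` on the singleton members) by the cluster expansion ((357)'s linear letter: `‖log Z_ψ‖ ≤ η_D`,
# `‖e^w − 1‖ ≤ 2‖w‖`), large fields by STABILITY (`‖Z_ψ(𝒜)‖ ≤ S·A_τ^{#cells}·e^{½κ₁Σψ²}` for ALL `ψ`) and the margin `κ⁺ − κ₁` converting the
# excess `Σ_{cells D}ψ² ≥ Ψ²` into the penalty `e^{−(κ⁺−κ₁)Ψ²∕2}` — exactly (290)'s `road_factor_regulated` (stability rate `κ₀`, format rate
# `κ ≥ 2κ₀`, margin `(κ∕2−κ₀)h²`) with the roles `κ₀ ↦ κ₁∕2`, `h ↦ Ψ`, `c₃vh³ ↦ η_D`: the next SINGLETON factor (block `p'`, cells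
# `cell' p' = ⋃_{p∈blk p'}cell p`) is REGULATED `(ε⁺, κ⁺)` in (289)'s format — SCOPING-d6′ (L4) (row NE7b, node U5c; [folklore])

Cell `pub-balaban`, sub-cell `t4`, spine estimate NE7b (`T4WeightBudget.RelWeightBound`; the cell's OWN estimate — NOT PRINTED in
[Bałaban 1983–89], NOT PROVED).  Crux-route work under `Spine/NE7b/` by the row OWNER (`t4-ne7b-p1` gen 135, file (371)) under FREEZE
(0)'s crux-prover clause, on `g134/records/SCOPING-d6-iteration.md` DECISION (d6′)(1) («L4 re-scoped: the regulated letter of the next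
single-block factor from the UNEXPANDED integral — stability + penalty, all `ψ`»); NOTHING of Bałaban's is named as a Lean object, valued or
asserted; no `T4Continuum/Support` leaf typed; no `def`, no notation; zero `sorry`.  Imports (BY NAME): the OWNER's (355) `…SupPolymerLocalStep`
(`cutoff_shifted_measurable_sets`, `cutoff_shifted_reg`, `cutoff_shifted_sup`), (357) `…SupPolymerLocalSmallnessLinear` (`exp_setLogZ_linear`,
`norm_setLogZ_le_linear`), (353) (`gaussian_set_hypotheses`), (351) (`biUnion_cells_pairwiseDisjoint`), (296) (`pertZ_cutoff`), (292)
(`sum_add_sq_le`), (289) (`one_le_regulatorCost`), (288) (`integral_exp_half_sq_on_le`, `integrable_exp_half_sq_on`),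
(368) (`eps''_pos`); Mathlib's `Complex.norm_exp_sub_one_le`, `Real.add_one_le_exp`, `Finset.sum_pow_mul_eq_add_pow`,
`Finset.prod_filter_mul_prod_filter_not`.

WHAT IS PROVED ([folklore]; `Z_ψ(𝒜) := pertZ N(0,Γ) (X ω ↦ f_X(ω+ψ)) 𝒜`, `𝒜₁ :=` the singleton members, `U := cells of ⋃𝒜₁`):
* §1 real analysis: `one_add_mul_le` (`1 + εE ≤ (1+ε)E` for `E ≥ 1`), `norm_one_add_le`, `prod_one_add_pow_le_exp` (`S ≤ e^{(1+ε)^{#D}}` for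
  `𝒜 ⊆ 𝒫(D)`), `large_field_conversion` (`Ψ² ≤ s`, `κ₁ ≤ κ⁺ ⟹ C·e^{½κ₁s} ≤ C·e^{−(κ⁺−κ₁)Ψ²∕2}·e^{½κ⁺s}`);
* §2 POINTWISE STABILITY **`norm_prod_one_add_shifted_le`** (`‖∏_{X∈𝒜}(1 + f_X(ω+ψ))‖ ≤ S·e^{½κ₁Σ_Uψ²}·e^{½κ(1+τ)Σ_Uω²}`, every `ω, ψ`);
* §3 INTEGRATED STABILITY **`norm_pertZ_shifted_le`** (`‖Z_ψ(𝒜)‖ ≤ S·A_τ^{#U}·e^{½κ₁Σ_Uψ²}` for EVERY `ψ` — no smallness, no range, no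
  measurability), `norm_pertZ_shifted_le_on` (the same read on any `D ⊇` the singleton members: `A_τ^{#cells D}`, `Σ_{cells D}`);
* §4 SMALL FIELDS **`norm_pertZ_shifted_sub_one_le_small`** (`Σ_{cell p}ψ² ≤ Ψ²` on the singleton members, `η_D ≤ 1∕2` ⟹ `‖Z_ψ(𝒜) − 1‖ ≤ 2η_D`;
  finite range + cell-measurability for `e^{log Z} = Z`);
* §5 THE END **`norm_pertZ_shifted_sub_one_le_regulated`** (the displayed all-`ψ` bound); §6 toy.  The reading in (289)'s format for blocks
  (one `ε⁺` uniform in the block, `S ≤ e^{(1+ε)^b}`, `A_τ^{#cells} ≤ A_τ^{vb}`), the locality and the cell-measurability of `ψ ↦ Z_ψ(𝒜)` are the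
  successor file (372).

HONEST (what this is NOT).  (i) The price of the regulated format one scale up is READ OFF, not removed: `ε⁺ ≤ C·ε` needs BOTH `ε″ = εe^{½κ₁Ψ²}A^v`
small (so `½κ₁Ψ² < log(1∕ε)`) AND `(1+SA^{vb})e^{−(κ⁺−κ₁)Ψ²∕2} ≲ ε` (so `½(κ⁺−κ₁)Ψ² > log(1∕ε)`), i.e. `κ⁺ > 2κ₁ = 2κ(1+τ⁻¹)`: the regulator RATE at
least doubles per step in the same field units — (290)'s `κ ≥ 2κ₀` seen again one scale up.  Regenerating the rate is the job of the field
RESCALING (`ψ ↦ L^{−[φ]}ψ'` shrinks `Σ_{cells}ψ²` per next-scale site), i.e. NC-NE7b-α's analytic half — untouched here; the alternative bookkeeping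
(do not store the large-field growth in the format; pay the component penalty at the next integration, (335)∕(343)) is the lineage's other
road and is not repeated.  (ii) The measurability of `ψ ↦ Z_ψ(𝒜)` in the cells of `D` and the identification `Σ_{∅≠Y⊆D}K⁺_Y(ψ) = log Z_ψ(𝒳|_D)`
(the blocked singleton term of (367) IS the logarithm of this unexpanded factor at small `ψ`) are the successor files.  (iii) Same sites, one
Gaussian step; scalar skeleton ((A3), NC-NE7b-α UNRULED); nothing of Bałaban's asserted.  BY-NAME EFFECT ON THE WALL: NONE.  NE7b NOT PRINTED ∕
NOT PROVED; spine PROVED 0∕9; rung (B)+1 — the programme's measures remain FINITE-torus statements; NOT the mass gap, NOT Clay.  HONEST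
DEPENDENCY: continuum YM on T⁴ ⇐ BetaPertH ∧ nine spine estimates (0∕9 proved); BetaPertH ⇐ (D1) ∧ (D4) ∧ CAP+tail; G-an2-4 gates asym, D1 and
NE2∕3∕4.
-/

set_option autoImplicit false

noncomputable section

namespace Summit.QuantumFields.BalabanUV.T4Continuum.NE7b.SupNextSingletonRegulated

open MeasureTheory ProbabilityTheory Finset Real
open scoped BigOperators
open Literature.Probability.LatticeModels
open Literature.Analysis.Matrix (HasFiniteRange)
open SupLocalisedPolymerGas (pertZ_cutoff)
open SupPolymerLocalStep (cutoff_shifted_measurable_sets cutoff_shifted_reg cutoff_shifted_sup)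
open SupPolymerLocalExpansion (gaussian_set_hypotheses)
open SupPolymerLocalSmallnessLinear (exp_setLogZ_linear norm_setLogZ_le_linear)
open SupPolymerLocalActivityBound (biUnion_cells_pairwiseDisjoint)
open SupRegulatedActivityShift (sum_add_sq_le)
open SupRegulatedActivityBound (one_le_regulatorCost)
open SupGaussianRegulator (integral_exp_half_sq_on_le integrable_exp_half_sq_on)
open SupPolymerLocalStepLinearLetter (eps''_pos)

variable {V : Type*} [DecidableEq V] {R : V → V → Prop} [DecidableRel R] {nbr : V → Finset V} {Δ : ℕ}
variable {ι : Type} [Fintype ι] [DecidableEq ι]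

/-! ## §1. Real analysis -/

omit [DecidableEq V] [DecidableRel R] [Fintype ι] [DecidableEq ι] in
/-- `1 ≤ E` ⟹ `1 + ε·E ≤ (1 + ε)·E` (any real `ε`). [folklore] -/
theorem one_add_mul_le (ε : ℝ) {E : ℝ} (hE : 1 ≤ E) : 1 + ε * E ≤ (1 + ε) * E := by nlinarith

omit [DecidableEq V] [DecidableRel R] [Fintype ι] [DecidableEq ι] in
/-- `‖1 + z‖ ≤ 1 + ‖z‖`. [folklore] -/
theorem norm_one_add_le (z : ℂ) : ‖1 + z‖ ≤ 1 + ‖z‖ := (norm_add_le 1 z).trans (by rw [norm_one])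

omit [DecidableEq V] [DecidableRel R] [Fintype ι] [DecidableEq ι] in
/-- **The stability constant is uniform in the block**: `𝒜 ⊆ 𝒫(D)`, `0 ≤ ε` ⟹ `∏_{X∈𝒜}(1 + ε^{#X}) ≤ e^{Σ_{X⊆D}ε^{#X}} = e^{(1+ε)^{#D}}`. [folklore] -/
theorem prod_one_add_pow_le_exp {ε : ℝ} (hε : 0 ≤ ε) {𝒜 : Finset (Finset V)} {D : Finset V} (h𝒜D : ∀ X ∈ 𝒜, X ⊆ D) :
    ∏ X ∈ 𝒜, (1 + ε ^ X.card) ≤ Real.exp ((1 + ε) ^ D.card) := by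
  have hsub : 𝒜 ⊆ D.powerset := fun X hX => mem_powerset.2 (h𝒜D X hX)
  calc ∏ X ∈ 𝒜, (1 + ε ^ X.card) ≤ ∏ X ∈ 𝒜, Real.exp (ε ^ X.card) :=
        prod_le_prod (fun X _ => by positivity) fun X _ => by linarith [add_one_le_exp (ε ^ X.card)]
    _ = Real.exp (∑ X ∈ 𝒜, ε ^ X.card) := by rw [Real.exp_sum]
    _ ≤ Real.exp (∑ X ∈ D.powerset, ε ^ X.card) :=
        exp_le_exp.2 (sum_le_sum_of_subset_of_nonneg hsub fun X _ _ => pow_nonneg hε _)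
    _ = Real.exp ((1 + ε) ^ D.card) := by
        congr 1
        rw [add_comm, ← Finset.sum_pow_mul_eq_add_pow ε 1 D]
        exact sum_congr rfl fun X _ => by rw [one_pow, mul_one]

omit [DecidableEq V] [DecidableRel R] [Fintype ι] [DecidableEq ι] in
/-- **LARGE-FIELD CONVERSION**: `0 ≤ C`, `κ₁ ≤ κ⁺`, `Ψ² ≤ s` ⟹ `C·e^{½κ₁s} ≤ (C·e^{−(κ⁺−κ₁)Ψ²∕2})·e^{½κ⁺s}` (the excess rate `κ⁺ − κ₁` on the
excess field `s ≥ Ψ²` is the penalty). [folklore] -/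
theorem large_field_conversion {C κ₁ κ' Ψ s : ℝ} (hC : 0 ≤ C) (hκ : κ₁ ≤ κ') (hs : Ψ ^ 2 ≤ s) :
    C * Real.exp (κ₁ * s / 2) ≤ C * Real.exp (-((κ' - κ₁) * Ψ ^ 2 / 2)) * Real.exp (κ' * s / 2) := by
  rw [mul_assoc, ← Real.exp_add]
  refine mul_le_mul_of_nonneg_left (exp_le_exp.2 ?_) hC
  have h := mul_le_mul_of_nonneg_left hs (sub_nonneg.2 hκ)
  nlinarith [h]

/-! ## §2. Pointwise stability of the unexpanded product -/

omit [DecidableEq V] [DecidableRel R] [Fintype ι] in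
/-- **ONE SHIFTED SINGLETON FACTOR**: `‖f_X(ω)‖ ≤ ε^{#X}e^{½κΣ_{cells X}ω²}`, `#X = 1`, `0 ≤ ε`, `0 ≤ κ`, `0 < τ` ⟹
`‖1 + f_X(ω+ψ)‖ ≤ (1 + ε^{#X})·e^{½κ(1+τ⁻¹)Σ_{cells X}ψ²}·e^{½κ(1+τ)Σ_{cells X}ω²}`. [folklore] -/
theorem norm_one_add_shifted_singleton_le (cell : V → Finset ι) {f : Finset V → EuclideanSpace ℝ ι → ℂ} {ε κ τ : ℝ} (hε : 0 ≤ ε)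
    (hκ : 0 ≤ κ) (hτ : 0 < τ) {X : Finset V} (hX1 : X.card = 1)
    (hreg : ∀ ω : EuclideanSpace ℝ ι, ‖f X ω‖ ≤ ε ^ X.card * exp (κ * (∑ x ∈ X.biUnion cell, ω x ^ 2) / 2))
    (ψ ω : EuclideanSpace ℝ ι) :
    ‖1 + f X (ω + ψ)‖ ≤ (1 + ε ^ X.card) * (exp (κ * (1 + τ⁻¹) * (∑ x ∈ X.biUnion cell, ψ x ^ 2) / 2) *
      exp (κ * (1 + τ) * (∑ x ∈ X.biUnion cell, ω x ^ 2) / 2)) := by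
  rw [hX1, pow_one]
  have h := hreg (ω + ψ)
  rw [hX1, pow_one] at h
  have hsum : ∑ x ∈ X.biUnion cell, (ω + ψ) x ^ 2 = ∑ x ∈ X.biUnion cell, (ω x + ψ x) ^ 2 :=
    sum_congr rfl fun x _ => by simp only [WithLp.ofLp_add, Pi.add_apply]
  rw [hsum] at h
  have hy := sum_add_sq_le (X.biUnion cell) (fun x => ω x) (fun x => ψ x) hτ
  -- the shifted factor is at most `ε·E·F`
  set E : ℝ := exp (κ * (1 + τ⁻¹) * (∑ x ∈ X.biUnion cell, ψ x ^ 2) / 2) with hE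
  set F : ℝ := exp (κ * (1 + τ) * (∑ x ∈ X.biUnion cell, ω x ^ 2) / 2) with hF
  have hEF : exp (κ * (∑ x ∈ X.biUnion cell, (ω x + ψ x) ^ 2) / 2) ≤ E * F := by
    rw [hE, hF, ← exp_add]
    refine exp_le_exp.2 ?_
    have := mul_le_mul_of_nonneg_left hy hκ
    nlinarith [this]
  have hfX : ‖f X (ω + ψ)‖ ≤ ε * (E * F) := h.trans (mul_le_mul_of_nonneg_left hEF hε)
  have hE1 : 1 ≤ E := one_le_exp (by positivity)
  have hF1 : 1 ≤ F := one_le_exp (by positivity)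
  have hEF1 : 1 ≤ E * F := one_le_mul_of_one_le_of_one_le hE1 hF1
  calc ‖1 + f X (ω + ψ)‖ ≤ 1 + ‖f X (ω + ψ)‖ := norm_one_add_le _
    _ ≤ 1 + ε * (E * F) := by linarith
    _ ≤ (1 + ε) * (E * F) := one_add_mul_le ε hEF1

omit [DecidableEq V] [DecidableRel R] [Fintype ι] [DecidableEq ι] in
/-- **ONE SHIFTED SUP-SMALL FACTOR**: `‖f_X‖ ≤ ε^{#X}` ⟹ `‖1 + f_X(ω+ψ)‖ ≤ 1 + ε^{#X}`. [folklore] -/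
theorem norm_one_add_shifted_sup_le {f : Finset V → EuclideanSpace ℝ ι → ℂ} {ε : ℝ} {X : Finset V}
    (hsup : ∀ ω : EuclideanSpace ℝ ι, ‖f X ω‖ ≤ ε ^ X.card) (ψ ω : EuclideanSpace ℝ ι) : ‖1 + f X (ω + ψ)‖ ≤ 1 + ε ^ X.card :=
  (norm_one_add_le _).trans (by linarith [hsup (ω + ψ)])

omit [DecidableRel R] [Fintype ι] in
/-- **POINTWISE STABILITY OF THE UNEXPANDED PRODUCT, FOR EVERY FIELD.**  Disjoint cells; singleton members of `𝒜` regulated `(ε, κ)`, the others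
sup-small; `0 ≤ ε`, `0 ≤ κ`, `0 < τ` ⟹ with `𝒜₁ = {X ∈ 𝒜 : #X = 1}` and `U = ⋃_{p∈⋃𝒜₁}cell p`, for every `ω, ψ`:
`‖∏_{X∈𝒜}(1 + f_X(ω+ψ))‖ ≤ (∏_{X∈𝒜}(1 + ε^{#X}))·e^{½κ(1+τ⁻¹)Σ_{x∈U}ψ_x²}·e^{½κ(1+τ)Σ_{x∈U}ω_x²}`. [folklore] -/
theorem norm_prod_one_add_shifted_le (cell : V → Finset ι) (hdisj : ∀ p q, p ≠ q → Disjoint (cell p) (cell q))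
    {f : Finset V → EuclideanSpace ℝ ι → ℂ} {ε κ τ : ℝ} (hε : 0 ≤ ε) (hκ : 0 ≤ κ) (hτ : 0 < τ) (𝒜 : Finset (Finset V))
    (hreg : ∀ X ∈ 𝒜, X.card = 1 → ∀ ω : EuclideanSpace ℝ ι, ‖f X ω‖ ≤ ε ^ X.card * exp (κ * (∑ x ∈ X.biUnion cell, ω x ^ 2) / 2))
    (hsup : ∀ X ∈ 𝒜, X.card ≠ 1 → ∀ ω : EuclideanSpace ℝ ι, ‖f X ω‖ ≤ ε ^ X.card) (ψ ω : EuclideanSpace ℝ ι) :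
    ‖∏ X ∈ 𝒜, (1 + f X (ω + ψ))‖ ≤ (∏ X ∈ 𝒜, (1 + ε ^ X.card)) *
      (exp (κ * (1 + τ⁻¹) * (∑ x ∈ ((𝒜.filter fun X => X.card = 1).biUnion id).biUnion cell, ψ x ^ 2) / 2) *
        exp (κ * (1 + τ) * (∑ x ∈ ((𝒜.filter fun X => X.card = 1).biUnion id).biUnion cell, ω x ^ 2) / 2)) := by
  set 𝒜₁ := 𝒜.filter fun X => X.card = 1 with h𝒜₁
  -- distinct singletons are disjoint, so their cell unions are pairwise disjoint
  have hpw : ∀ X ∈ 𝒜₁, ∀ Y ∈ 𝒜₁, X ≠ Y → Disjoint X Y := by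
    intro X hX Y hY hXY
    obtain ⟨a, rfl⟩ := card_eq_one.1 (mem_filter.1 hX).2
    obtain ⟨b, rfl⟩ := card_eq_one.1 (mem_filter.1 hY).2
    rw [disjoint_singleton_left, mem_singleton]
    exact fun hab => hXY (by rw [hab])
  have hpd := biUnion_cells_pairwiseDisjoint cell hdisj hpw
  have hSψ : ∑ x ∈ (𝒜₁.biUnion id).biUnion cell, ψ x ^ 2 = ∑ X ∈ 𝒜₁, ∑ x ∈ X.biUnion cell, ψ x ^ 2 := by
    rw [Finset.biUnion_biUnion]
    simp only [id_eq]
    exact sum_biUnion hpd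
  have hSω : ∑ x ∈ (𝒜₁.biUnion id).biUnion cell, ω x ^ 2 = ∑ X ∈ 𝒜₁, ∑ x ∈ X.biUnion cell, ω x ^ 2 := by
    rw [Finset.biUnion_biUnion]
    simp only [id_eq]
    exact sum_biUnion hpd
  -- split both products into singletons and the rest
  rw [← prod_filter_mul_prod_filter_not 𝒜 (fun X => X.card = 1) (fun X => 1 + f X (ω + ψ)),
    ← prod_filter_mul_prod_filter_not 𝒜 (fun X => X.card = 1) (fun X => (1 : ℝ) + ε ^ X.card), norm_mul]
  have h1 : ‖∏ X ∈ 𝒜₁, (1 + f X (ω + ψ))‖ ≤ (∏ X ∈ 𝒜₁, (1 + ε ^ X.card)) *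
      (exp (κ * (1 + τ⁻¹) * (∑ x ∈ (𝒜₁.biUnion id).biUnion cell, ψ x ^ 2) / 2) *
        exp (κ * (1 + τ) * (∑ x ∈ (𝒜₁.biUnion id).biUnion cell, ω x ^ 2) / 2)) := by
    rw [norm_prod]
    calc ∏ X ∈ 𝒜₁, ‖1 + f X (ω + ψ)‖
        ≤ ∏ X ∈ 𝒜₁, ((1 + ε ^ X.card) * (exp (κ * (1 + τ⁻¹) * (∑ x ∈ X.biUnion cell, ψ x ^ 2) / 2) *
            exp (κ * (1 + τ) * (∑ x ∈ X.biUnion cell, ω x ^ 2) / 2))) :=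
          prod_le_prod (fun X _ => norm_nonneg _) fun X hX =>
            norm_one_add_shifted_singleton_le cell hε hκ hτ (mem_filter.1 hX).2 (hreg X (mem_filter.1 hX).1 (mem_filter.1 hX).2) ψ ω
      _ = (∏ X ∈ 𝒜₁, (1 + ε ^ X.card)) *
          (exp (κ * (1 + τ⁻¹) * (∑ x ∈ (𝒜₁.biUnion id).biUnion cell, ψ x ^ 2) / 2) *
            exp (κ * (1 + τ) * (∑ x ∈ (𝒜₁.biUnion id).biUnion cell, ω x ^ 2) / 2)) := by
          rw [prod_mul_distrib, prod_mul_distrib, ← Real.exp_sum, ← Real.exp_sum, hSψ, hSω, mul_sum, mul_sum, sum_div, sum_div]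
  have h2 : ‖∏ X ∈ 𝒜 with ¬ X.card = 1, (1 + f X (ω + ψ))‖ ≤ ∏ X ∈ 𝒜 with ¬ X.card = 1, (1 + ε ^ X.card) := by
    rw [norm_prod]
    exact prod_le_prod (fun X _ => norm_nonneg _) fun X hX =>
      norm_one_add_shifted_sup_le (hsup X (mem_filter.1 hX).1 (mem_filter.1 hX).2) ψ ω
  have h2' : 0 ≤ ∏ X ∈ 𝒜 with ¬ X.card = 1, ((1 : ℝ) + ε ^ X.card) := prod_nonneg fun X _ => by positivity
  calc ‖∏ X ∈ 𝒜₁, (1 + f X (ω + ψ))‖ * ‖∏ X ∈ 𝒜 with ¬ X.card = 1, (1 + f X (ω + ψ))‖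
      ≤ ((∏ X ∈ 𝒜₁, (1 + ε ^ X.card)) *
          (exp (κ * (1 + τ⁻¹) * (∑ x ∈ (𝒜₁.biUnion id).biUnion cell, ψ x ^ 2) / 2) *
            exp (κ * (1 + τ) * (∑ x ∈ (𝒜₁.biUnion id).biUnion cell, ω x ^ 2) / 2))) *
        ∏ X ∈ 𝒜 with ¬ X.card = 1, (1 + ε ^ X.card) := mul_le_mul h1 h2 (norm_nonneg _) (by positivity)
    _ = (∏ X ∈ 𝒜₁, (1 + ε ^ X.card)) * (∏ X ∈ 𝒜 with ¬ X.card = 1, (1 + ε ^ X.card)) *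
        (exp (κ * (1 + τ⁻¹) * (∑ x ∈ (𝒜₁.biUnion id).biUnion cell, ψ x ^ 2) / 2) *
          exp (κ * (1 + τ) * (∑ x ∈ (𝒜₁.biUnion id).biUnion cell, ω x ^ 2) / 2)) := by ring

/-! ## §3. Integrated stability: the unexpanded block integral is bounded for EVERY external field -/

omit [DecidableRel R] in
/-- **STABILITY OF THE UNEXPANDED BLOCK INTEGRAL, FOR EVERY EXTERNAL FIELD.**  `Γ ⪰ 0`, `Γ ⪯ γ_op·1`, diagonal `≤ γ`; disjoint cells;
singleton members of `𝒜` regulated `(ε, κ)`, the others sup-small; `0 ≤ ε`, `0 ≤ κ`, `0 < τ`, `0 < θ < 1`, `κ(1+τ)γ_op ≤ θ` ⟹ for EVERY `ψ`: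
`‖Z_ψ(𝒜)‖ ≤ (∏_{X∈𝒜}(1 + ε^{#X}))·A_τ^{#U}·e^{½κ(1+τ⁻¹)Σ_{x∈U}ψ_x²}`, `A_τ = (1−θ)^{−κ(1+τ)γ∕(2θ)}`, `U` the cells of the singleton members —
no smallness, no finite range, no measurability. [folklore] -/
theorem norm_pertZ_shifted_le {Γ : Matrix ι ι ℝ} {γop γ : ℝ} (hΓ : Γ.PosSemidef) (hΓop : (γop • (1 : Matrix ι ι ℝ) - Γ).PosSemidef)
    (hdiag : ∀ i, Γ i i ≤ γ) (cell : V → Finset ι) (hdisj : ∀ p q, p ≠ q → Disjoint (cell p) (cell q))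
    {f : Finset V → EuclideanSpace ℝ ι → ℂ} {ε κ τ θ : ℝ} (hε : 0 ≤ ε) (hκ : 0 ≤ κ) (hτ : 0 < τ) (hθ0 : 0 < θ) (hθ1 : θ < 1)
    (hκθ : κ * (1 + τ) * γop ≤ θ) (𝒜 : Finset (Finset V))
    (hreg : ∀ X ∈ 𝒜, X.card = 1 → ∀ ω : EuclideanSpace ℝ ι, ‖f X ω‖ ≤ ε ^ X.card * exp (κ * (∑ x ∈ X.biUnion cell, ω x ^ 2) / 2))
    (hsup : ∀ X ∈ 𝒜, X.card ≠ 1 → ∀ ω : EuclideanSpace ℝ ι, ‖f X ω‖ ≤ ε ^ X.card) (ψ : EuclideanSpace ℝ ι) :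
    ‖pertZ (multivariateGaussian 0 Γ) (fun X ω => f X (ω + ψ)) 𝒜‖ ≤ (∏ X ∈ 𝒜, (1 + ε ^ X.card)) *
      ((1 - θ) ^ (-(κ * (1 + τ) * γ / (2 * θ)))) ^ (((𝒜.filter fun X => X.card = 1).biUnion id).biUnion cell).card *
        exp (κ * (1 + τ⁻¹) * (∑ x ∈ ((𝒜.filter fun X => X.card = 1).biUnion id).biUnion cell, ψ x ^ 2) / 2) := by
  set μ := multivariateGaussian 0 Γ with hμ
  set U := ((𝒜.filter fun X => X.card = 1).biUnion id).biUnion cell with hU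
  set S : ℝ := ∏ X ∈ 𝒜, (1 + ε ^ X.card) with hS
  set Eψ : ℝ := exp (κ * (1 + τ⁻¹) * (∑ x ∈ U, ψ x ^ 2) / 2) with hEψ
  have hκ' : 0 ≤ κ * (1 + τ) := by positivity
  have hS0 : 0 ≤ S := prod_nonneg fun X _ => by positivity
  have hint := integrable_exp_half_sq_on hΓ hΓop hκ' hθ1 hκθ U
  have hgauss := integral_exp_half_sq_on_le hΓ hΓop hκ' hθ0 hθ1 hκθ U fun i _ => hdiag i
  unfold pertZ
  calc ‖∫ ω, ∏ X ∈ 𝒜, (1 + f X (ω + ψ)) ∂μ‖ ≤ ∫ ω, ‖∏ X ∈ 𝒜, (1 + f X (ω + ψ))‖ ∂μ := norm_integral_le_integral_norm _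
    _ ≤ ∫ ω, S * Eψ * exp (κ * (1 + τ) * (∑ x ∈ U, ω x ^ 2) / 2) ∂μ := by
        refine integral_mono_of_nonneg (ae_of_all _ fun _ => norm_nonneg _) (hint.const_mul _) (ae_of_all _ fun ω => ?_)
        have h := norm_prod_one_add_shifted_le cell hdisj hε hκ hτ 𝒜 hreg hsup ψ ω
        rw [← hU] at h
        calc ‖∏ X ∈ 𝒜, (1 + f X (ω + ψ))‖ ≤ S * (Eψ * exp (κ * (1 + τ) * (∑ x ∈ U, ω x ^ 2) / 2)) := h
          _ = S * Eψ * exp (κ * (1 + τ) * (∑ x ∈ U, ω x ^ 2) / 2) := by ring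
    _ = S * Eψ * ∫ ω, exp (κ * (1 + τ) * (∑ x ∈ U, ω x ^ 2) / 2) ∂μ := integral_const_mul _ _
    _ ≤ S * Eψ * ((1 - θ) ^ (-(κ * (1 + τ) * γ / (2 * θ)))) ^ U.card := mul_le_mul_of_nonneg_left hgauss (by positivity)
    _ = S * ((1 - θ) ^ (-(κ * (1 + τ) * γ / (2 * θ)))) ^ U.card * Eψ := by ring

omit [DecidableRel R] [Fintype ι] in
/-- The cells of the singleton members lie inside the cells of any `D` containing the members of `𝒜`. [folklore] -/
theorem singletonCells_subset (cell : V → Finset ι) {𝒜 : Finset (Finset V)} {D : Finset V} (h𝒜D : ∀ X ∈ 𝒜, X ⊆ D) :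
    ((𝒜.filter fun X => X.card = 1).biUnion id).biUnion cell ⊆ D.biUnion cell := by
  refine biUnion_subset_biUnion_of_subset_left cell fun p hp => ?_
  obtain ⟨X, hX, hpX⟩ := mem_biUnion.1 hp
  exact h𝒜D X (mem_filter.1 hX).1 (by simpa using hpX)

omit [DecidableRel R] in
/-- **STABILITY READ ON THE BLOCK**: members of `𝒜` inside `D` ⟹ for EVERY `ψ`,
`‖Z_ψ(𝒜)‖ ≤ (∏_{X∈𝒜}(1 + ε^{#X}))·A_τ^{#cells D}·e^{½κ(1+τ⁻¹)Σ_{x∈cells D}ψ_x²}`. [folklore] -/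
theorem norm_pertZ_shifted_le_on {Γ : Matrix ι ι ℝ} {γop γ : ℝ} (hΓ : Γ.PosSemidef) (hΓop : (γop • (1 : Matrix ι ι ℝ) - Γ).PosSemidef)
    (hdiag : ∀ i, Γ i i ≤ γ) (hγ : 0 ≤ γ) (cell : V → Finset ι) (hdisj : ∀ p q, p ≠ q → Disjoint (cell p) (cell q))
    {f : Finset V → EuclideanSpace ℝ ι → ℂ} {ε κ τ θ : ℝ} (hε : 0 ≤ ε) (hκ : 0 ≤ κ) (hτ : 0 < τ) (hθ0 : 0 < θ) (hθ1 : θ < 1)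
    (hκθ : κ * (1 + τ) * γop ≤ θ) (𝒜 : Finset (Finset V)) {D : Finset V} (h𝒜D : ∀ X ∈ 𝒜, X ⊆ D)
    (hreg : ∀ X ∈ 𝒜, X.card = 1 → ∀ ω : EuclideanSpace ℝ ι, ‖f X ω‖ ≤ ε ^ X.card * exp (κ * (∑ x ∈ X.biUnion cell, ω x ^ 2) / 2))
    (hsup : ∀ X ∈ 𝒜, X.card ≠ 1 → ∀ ω : EuclideanSpace ℝ ι, ‖f X ω‖ ≤ ε ^ X.card) (ψ : EuclideanSpace ℝ ι) :
    ‖pertZ (multivariateGaussian 0 Γ) (fun X ω => f X (ω + ψ)) 𝒜‖ ≤ (∏ X ∈ 𝒜, (1 + ε ^ X.card)) *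
      ((1 - θ) ^ (-(κ * (1 + τ) * γ / (2 * θ)))) ^ (D.biUnion cell).card *
        exp (κ * (1 + τ⁻¹) * (∑ x ∈ D.biUnion cell, ψ x ^ 2) / 2) := by
  have hκγ : 0 ≤ κ * (1 + τ) * γ := by positivity
  have hA1 : 1 ≤ (1 - θ) ^ (-(κ * (1 + τ) * γ / (2 * θ))) := one_le_regulatorCost hκγ hθ0 hθ1
  have hUD := singletonCells_subset cell h𝒜D
  have hS0 : 0 ≤ ∏ X ∈ 𝒜, ((1 : ℝ) + ε ^ X.card) := prod_nonneg fun X _ => by positivity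
  refine (norm_pertZ_shifted_le hΓ hΓop hdiag cell hdisj hε hκ hτ hθ0 hθ1 hκθ 𝒜 hreg hsup ψ).trans ?_
  refine mul_le_mul (mul_le_mul_of_nonneg_left (pow_le_pow_right₀ hA1 (card_le_card hUD)) hS0) (exp_le_exp.2 ?_) (exp_pos _).le
    (by positivity)
  have h1 : 0 ≤ κ * (1 + τ⁻¹) := by positivity
  have h2 := sum_le_sum_of_subset_of_nonneg hUD (f := fun x => ψ x ^ 2) fun x _ _ => sq_nonneg (ψ x)
  have := mul_le_mul_of_nonneg_left h2 h1
  linarith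

/-! ## §4. Small fields: the cluster expansion gives `‖Z_ψ(𝒜) − 1‖ ≤ 2η_D` -/

/-- **SMALL FIELDS.**  `Γ ⪰ 0` of range `ρ` for `dι`, `Γ ⪯ γ_op·1`, diagonal `≤ γ` (`γ ≥ 0`); disjoint cells of `≤ v` sites; `R` symmetric covering
`ρ`-closeness with `≤ Δ` neighbours; members of `𝒜` `R`-connected with factors measurable in their cells, singletons regulated `(ε, κ)` (`0 < ε`),
the others sup-small; `0 ≤ κ`, `0 < τ`, `0 < θ < 1`, `κ(1+τ)γ_op ≤ θ`; the external field with `Σ_{cells X}ψ² ≤ Ψ²` on the singleton members;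
`e·ε₁·(Δ+1)² ≤ 1∕2` and `η_D := #(⋃𝒜)(Δ+1)2e·ε₁ ≤ 1∕2` (`ε₁ = 2e(Δ+1)²ε″`) ⟹ `‖Z_ψ(𝒜) − 1‖ ≤ 2η_D`. [folklore] -/
theorem norm_pertZ_shifted_sub_one_le_small {Γ : Matrix ι ι ℝ} {γop γ : ℝ} (hΓ : Γ.PosSemidef)
    (hΓop : (γop • (1 : Matrix ι ι ℝ) - Γ).PosSemidef) (hdiag : ∀ i, Γ i i ≤ γ) (hγ : 0 ≤ γ) {dι : ι → ι → ℕ} {ρ : ℕ}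
    (hfr : HasFiniteRange dι ρ Γ) (cell : V → Finset ι) (hdisj : ∀ p q, p ≠ q → Disjoint (cell p) (cell q)) {v : ℕ}
    (hv : ∀ p, (cell p).card ≤ v) (hRsymm : ∀ x y, R x y → R y x)
    (hR : ∀ (p p' : V) (x y : ι), x ∈ cell p → y ∈ cell p' → dι x y ≤ ρ → p = p' ∨ R p p')
    (hΔ : ∀ x, (nbr x).card ≤ Δ) (hnbr : ∀ x y, R x y → y ∈ nbr x)
    {f : Finset V → EuclideanSpace ℝ ι → ℂ} {ε κ τ θ Ψ : ℝ} (hε : 0 < ε) (hκ : 0 ≤ κ) (hτ : 0 < τ) (hθ0 : 0 < θ) (hθ1 : θ < 1)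
    (hκθ : κ * (1 + τ) * γop ≤ θ) (𝒜 : Finset (Finset V)) (hconn : ∀ X ∈ 𝒜, IsRConnected R X)
    (hmeas : ∀ X ∈ 𝒜, Measurable[⨆ p ∈ X, MeasurableSpace.comap (fun (ω : EuclideanSpace ℝ ι) (x : cell p) => ω x) inferInstance] (f X))
    (hreg : ∀ X ∈ 𝒜, X.card = 1 → ∀ ω : EuclideanSpace ℝ ι, ‖f X ω‖ ≤ ε ^ X.card * exp (κ * (∑ x ∈ X.biUnion cell, ω x ^ 2) / 2))
    (hsup : ∀ X ∈ 𝒜, X.card ≠ 1 → ∀ ω : EuclideanSpace ℝ ι, ‖f X ω‖ ≤ ε ^ X.card) (ψ : EuclideanSpace ℝ ι)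
    (hψ : ∀ X ∈ 𝒜, X.card = 1 → ∑ x ∈ X.biUnion cell, ψ x ^ 2 ≤ Ψ ^ 2)
    (hsmall : Real.exp 1 * (2 * Real.exp 1 * ((Δ : ℝ) + 1) ^ 2 *
      ((ε * exp (κ * (1 + τ⁻¹) * Ψ ^ 2 / 2)) * ((1 - θ) ^ (-(κ * (1 + τ) * γ / (2 * θ)))) ^ v)) * ((Δ : ℝ) + 1) ^ 2 ≤ 1 / 2)
    (hη : (𝒜.biUnion id).card * ((Δ : ℝ) + 1) * (2 * (Real.exp 1 * (2 * Real.exp 1 * ((Δ : ℝ) + 1) ^ 2 *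
      ((ε * exp (κ * (1 + τ⁻¹) * Ψ ^ 2 / 2)) * ((1 - θ) ^ (-(κ * (1 + τ) * γ / (2 * θ)))) ^ v)))) ≤ 1 / 2) :
    ‖pertZ (multivariateGaussian 0 Γ) (fun X ω => f X (ω + ψ)) 𝒜 - 1‖ ≤
      2 * ((𝒜.biUnion id).card * ((Δ : ℝ) + 1) * (2 * (Real.exp 1 * (2 * Real.exp 1 * ((Δ : ℝ) + 1) ^ 2 *
        ((ε * exp (κ * (1 + τ⁻¹) * Ψ ^ 2 / 2)) * ((1 - θ) ^ (-(κ * (1 + τ) * γ / (2 * θ)))) ^ v))))) := by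
  have hκ' : 0 ≤ κ * (1 + τ) := by positivity
  have hεΨ : 0 ≤ ε * exp (κ * (1 + τ⁻¹) * Ψ ^ 2 / 2) := by positivity
  have hε'' := eps''_pos (Ψ := Ψ) (γ := γ) (v := v) hε hκ hτ hγ hθ0 hθ1
  -- the cut-off shifted factors meet the Gaussian hypotheses with `(ε_Ψ, κ(1+τ))`
  obtain ⟨hle, hindep, hint, hM, -⟩ := gaussian_set_hypotheses hΓ hΓop hdiag hγ hfr cell hdisj hv hR hεΨ hκ' hθ0 hθ1 hκθ
    (cutoff_shifted_measurable_sets cell 𝒜 hmeas ψ) (fun X hX1 ω => cutoff_shifted_reg cell hε.le hκ hτ 𝒜 hreg ψ hψ X hX1 ω)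
    (fun X hX1 ω => cutoff_shifted_sup hε.le hκ hτ 𝒜 hsup ψ X hX1 ω)
  have hexp := exp_setLogZ_linear hRsymm hΔ hnbr hle hindep (cutoff_shifted_measurable_sets cell 𝒜 hmeas ψ) hint 𝒜 hconn hε''
    (fun 𝒜' _ => hM 𝒜') hsmall
  have hlog := norm_setLogZ_le_linear hRsymm hΔ hnbr 𝒜 hconn hε'' (fun 𝒜' _ => hM 𝒜') hsmall
  rw [pertZ_cutoff] at hexp
  rw [← hexp]
  refine (Complex.norm_exp_sub_one_le (hlog.trans (hη.trans (by norm_num)))).trans ?_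
  linarith

/-! ## §5. THE END: the regulated letter of the next single-block factor, for every external field -/

/-- **THE NEXT SINGLE-BLOCK FACTOR IS REGULATED, FOR EVERY EXTERNAL FIELD.**  Under the hypotheses of `norm_pertZ_shifted_sub_one_le_small`
except the smallness of `ψ`, with the members of `𝒜` inside `D` and a next rate `κ⁺ ≥ κ₁ := κ(1+τ⁻¹)`: for EVERY `ψ`,
`‖Z_ψ(𝒜) − 1‖ ≤ max(2η_D, (1 + S·A_τ^{#cells D})·e^{−(κ⁺−κ₁)Ψ²∕2}) · e^{½κ⁺Σ_{x∈cells D}ψ_x²}`, `S = ∏_{X∈𝒜}(1 + ε^{#X})` (small fields: §4;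
a large field on a singleton member `{p} ⊆ D`: stability §3 + the conversion of §1). [folklore] -/
theorem norm_pertZ_shifted_sub_one_le_regulated {Γ : Matrix ι ι ℝ} {γop γ : ℝ} (hΓ : Γ.PosSemidef)
    (hΓop : (γop • (1 : Matrix ι ι ℝ) - Γ).PosSemidef) (hdiag : ∀ i, Γ i i ≤ γ) (hγ : 0 ≤ γ) {dι : ι → ι → ℕ} {ρ : ℕ}
    (hfr : HasFiniteRange dι ρ Γ) (cell : V → Finset ι) (hdisj : ∀ p q, p ≠ q → Disjoint (cell p) (cell q)) {v : ℕ}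
    (hv : ∀ p, (cell p).card ≤ v) (hRsymm : ∀ x y, R x y → R y x)
    (hR : ∀ (p p' : V) (x y : ι), x ∈ cell p → y ∈ cell p' → dι x y ≤ ρ → p = p' ∨ R p p')
    (hΔ : ∀ x, (nbr x).card ≤ Δ) (hnbr : ∀ x y, R x y → y ∈ nbr x)
    {f : Finset V → EuclideanSpace ℝ ι → ℂ} {ε κ τ θ Ψ : ℝ} (hε : 0 < ε) (hκ : 0 ≤ κ) (hτ : 0 < τ) (hθ0 : 0 < θ) (hθ1 : θ < 1)
    (hκθ : κ * (1 + τ) * γop ≤ θ) (𝒜 : Finset (Finset V)) (hconn : ∀ X ∈ 𝒜, IsRConnected R X) {D : Finset V}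
    (h𝒜D : ∀ X ∈ 𝒜, X ⊆ D)
    (hmeas : ∀ X ∈ 𝒜, Measurable[⨆ p ∈ X, MeasurableSpace.comap (fun (ω : EuclideanSpace ℝ ι) (x : cell p) => ω x) inferInstance] (f X))
    (hreg : ∀ X ∈ 𝒜, X.card = 1 → ∀ ω : EuclideanSpace ℝ ι, ‖f X ω‖ ≤ ε ^ X.card * exp (κ * (∑ x ∈ X.biUnion cell, ω x ^ 2) / 2))
    (hsup : ∀ X ∈ 𝒜, X.card ≠ 1 → ∀ ω : EuclideanSpace ℝ ι, ‖f X ω‖ ≤ ε ^ X.card) {κ' : ℝ} (hκ' : κ * (1 + τ⁻¹) ≤ κ')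
    (hsmall : Real.exp 1 * (2 * Real.exp 1 * ((Δ : ℝ) + 1) ^ 2 *
      ((ε * exp (κ * (1 + τ⁻¹) * Ψ ^ 2 / 2)) * ((1 - θ) ^ (-(κ * (1 + τ) * γ / (2 * θ)))) ^ v)) * ((Δ : ℝ) + 1) ^ 2 ≤ 1 / 2)
    (hη : (𝒜.biUnion id).card * ((Δ : ℝ) + 1) * (2 * (Real.exp 1 * (2 * Real.exp 1 * ((Δ : ℝ) + 1) ^ 2 *
      ((ε * exp (κ * (1 + τ⁻¹) * Ψ ^ 2 / 2)) * ((1 - θ) ^ (-(κ * (1 + τ) * γ / (2 * θ)))) ^ v)))) ≤ 1 / 2) (ψ : EuclideanSpace ℝ ι) :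
    ‖pertZ (multivariateGaussian 0 Γ) (fun X ω => f X (ω + ψ)) 𝒜 - 1‖ ≤
      max (2 * ((𝒜.biUnion id).card * ((Δ : ℝ) + 1) * (2 * (Real.exp 1 * (2 * Real.exp 1 * ((Δ : ℝ) + 1) ^ 2 *
              ((ε * exp (κ * (1 + τ⁻¹) * Ψ ^ 2 / 2)) * ((1 - θ) ^ (-(κ * (1 + τ) * γ / (2 * θ)))) ^ v))))))
          ((1 + (∏ X ∈ 𝒜, (1 + ε ^ X.card)) * ((1 - θ) ^ (-(κ * (1 + τ) * γ / (2 * θ)))) ^ (D.biUnion cell).card) *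
            Real.exp (-((κ' - κ * (1 + τ⁻¹)) * Ψ ^ 2 / 2))) *
        exp (κ' * (∑ x ∈ D.biUnion cell, ψ x ^ 2) / 2) := by
  have hZ := norm_pertZ_shifted_le_on hΓ hΓop hdiag hγ cell hdisj hε.le hκ hτ hθ0 hθ1 hκθ 𝒜 h𝒜D hreg hsup ψ
  set s : ℝ := ∑ x ∈ D.biUnion cell, ψ x ^ 2 with hs
  set SA : ℝ := (∏ X ∈ 𝒜, (1 + ε ^ X.card)) * ((1 - θ) ^ (-(κ * (1 + τ) * γ / (2 * θ)))) ^ (D.biUnion cell).card with hSA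
  have hs0 : 0 ≤ s := sum_nonneg fun x _ => sq_nonneg (ψ x)
  have hκ1 : 0 ≤ κ * (1 + τ⁻¹) := by positivity
  have hκ'0 : 0 ≤ κ' := hκ1.trans hκ'
  have hκγ : 0 ≤ κ * (1 + τ) * γ := by positivity
  have hA1 : 1 ≤ (1 - θ) ^ (-(κ * (1 + τ) * γ / (2 * θ))) := one_le_regulatorCost hκγ hθ0 hθ1
  have hSA0 : 0 ≤ SA := mul_nonneg (prod_nonneg fun X _ => by positivity) (pow_nonneg (zero_le_one.trans hA1) _)
  have hreg1 : 1 ≤ exp (κ' * s / 2) := one_le_exp (by positivity)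
  have hmax0 : 0 ≤ max (2 * ((𝒜.biUnion id).card * ((Δ : ℝ) + 1) * (2 * (Real.exp 1 * (2 * Real.exp 1 * ((Δ : ℝ) + 1) ^ 2 *
      ((ε * exp (κ * (1 + τ⁻¹) * Ψ ^ 2 / 2)) * ((1 - θ) ^ (-(κ * (1 + τ) * γ / (2 * θ)))) ^ v))))))
      ((1 + SA) * Real.exp (-((κ' - κ * (1 + τ⁻¹)) * Ψ ^ 2 / 2))) := le_trans (by positivity) (le_max_right _ _)
  by_cases hsm : ∀ X ∈ 𝒜, X.card = 1 → ∑ x ∈ X.biUnion cell, ψ x ^ 2 ≤ Ψ ^ 2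
  · -- small fields on every singleton member
    calc ‖pertZ (multivariateGaussian 0 Γ) (fun X ω => f X (ω + ψ)) 𝒜 - 1‖
        ≤ 2 * ((𝒜.biUnion id).card * ((Δ : ℝ) + 1) * (2 * (Real.exp 1 * (2 * Real.exp 1 * ((Δ : ℝ) + 1) ^ 2 *
            ((ε * exp (κ * (1 + τ⁻¹) * Ψ ^ 2 / 2)) * ((1 - θ) ^ (-(κ * (1 + τ) * γ / (2 * θ)))) ^ v))))) :=
          norm_pertZ_shifted_sub_one_le_small hΓ hΓop hdiag hγ hfr cell hdisj hv hRsymm hR hΔ hnbr hε hκ hτ hθ0 hθ1 hκθ 𝒜 hconn hmeas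
            hreg hsup ψ hsm hsmall hη
      _ ≤ _ := le_max_left _ _
      _ ≤ _ := le_mul_of_one_le_right hmax0 hreg1
  · -- a large field on some singleton member `{p} ⊆ D`
    push Not at hsm
    obtain ⟨X, hX𝒜, hX1, hXΨ⟩ := hsm
    have hXD : X.biUnion cell ⊆ D.biUnion cell := biUnion_subset_biUnion_of_subset_left cell (h𝒜D X hX𝒜)
    have hΨs : Ψ ^ 2 ≤ s :=
      hXΨ.le.trans (sum_le_sum_of_subset_of_nonneg hXD (f := fun x => ψ x ^ 2) fun x _ _ => sq_nonneg (ψ x))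
    have hE1 : 1 ≤ exp (κ * (1 + τ⁻¹) * s / 2) := one_le_exp (by positivity)
    calc ‖pertZ (multivariateGaussian 0 Γ) (fun X ω => f X (ω + ψ)) 𝒜 - 1‖
        ≤ ‖pertZ (multivariateGaussian 0 Γ) (fun X ω => f X (ω + ψ)) 𝒜‖ + ‖(1 : ℂ)‖ := norm_sub_le _ _
      _ ≤ SA * exp (κ * (1 + τ⁻¹) * s / 2) + 1 := by rw [norm_one]; linarith
      _ ≤ (1 + SA) * exp (κ * (1 + τ⁻¹) * s / 2) := by nlinarith
      _ ≤ (1 + SA) * Real.exp (-((κ' - κ * (1 + τ⁻¹)) * Ψ ^ 2 / 2)) * exp (κ' * s / 2) :=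
          large_field_conversion (by positivity) hκ' hΨs
      _ ≤ _ := mul_le_mul_of_nonneg_right (le_max_right _ _) (exp_pos _).le

/-! ## §6. Toy -/

omit [DecidableEq V] [DecidableRel R] [Fintype ι] [DecidableEq ι] in
/-- Toy (§1): with NO excess rate (`κ⁺ = κ₁`) the conversion is the identity up to `e^0 = 1`. -/
example {C κ₁ Ψ s : ℝ} (hC : 0 ≤ C) (hs : Ψ ^ 2 ≤ s) :
    C * Real.exp (κ₁ * s / 2) ≤ C * Real.exp (-((κ₁ - κ₁) * Ψ ^ 2 / 2)) * Real.exp (κ₁ * s / 2) :=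
  large_field_conversion hC le_rfl hs

end Summit.QuantumFields.BalabanUV.T4Continuum.NE7b.SupNextSingletonRegulated
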